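import Summits.FinalStateConjecture.FinalStateConjecture.Theorems.ZeroEnergyKerrOrBombOneLockedExplosionDefs
import Literature.Geometry.Lorentzian.StationaryFinalStateDecomposition
import Literature.Geometry.Lorentzian.KillingModeStability
import Literature.Geometry.Lorentzian.LinearizedRicci
import Literature.Geometry.Lorentzian.Volume
import Literature.Geometry.Lorentzian.KerrDataProofs
import Literature.Geometry.Lorentzian.KerrSchildCoord
import HarnessLib

/-!
# Route ZeroEnergyKerrOrBomb · crux `StationaryLimitReduction` — posited objects of the line
# `symplectic-dual-of-the-bomb` (route-posited definitions, D-0016 `<Route>Defs` convention)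

This file carries no mathematics beyond definitions (and definitional read-back lemmas). It is the
vocabulary (§0) of the line (the six registered stub STATEMENTS §1, `Sig.stub_*`, live in the companion
module `ZeroEnergyKerrOrBombSymplecticDualOfTheBombSig.lean`, which imports this one) `symplectic-dual-of-the-bomb` of crux stmt-FinalStateConjecture-10021
(`ZeroEnergyKerrOrBomb.StationaryLimitReduction := KerrOrBomb → FinalStateConjecture`) — checked skeleton
`Cruxes/StationaryLimitReduction/Lines/symplectic_dual_of_the_bomb.lean` (planner
planner-cruxplan-stmt-FinalStateConjecture-10021-symplectic-dual-of-t-0; reshape r1 by lead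
prover-line-stmt-FinalStateConjecture-10021-1; lead prover-line-stmt-FinalStateConjecture-10021-a1-0) —
moved VERBATIM out of the crux workfile (which has no `.olean`) so that stub proofs and helper lemmas can
land as `Theorems/…` files (`--supports stmt-FinalStateConjecture-10021`) importing their statements, exactly
as the sibling line did with `ZeroEnergyKerrOrBombOneLockedExplosionDefs.lean` (p85447), whose STABLE shared
vocabulary (`SummitProperty`, `InTelescope`, `IsKerrExterior`, `ChartIsAsymptoticallyCartesian`) is reused
here and not re-declared:

* §0 `ModeStable`, `IsKerrCharted`, `HoleBilinField`, `IsGravitationalModePair`, `BilinField`, `symInner`,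
  `hTrace`, `omegaDensity`, `chartPairing`, `famTangentH/K`, `pairingMatrix`, `IsSupportedIn`,
  `SmoothBilinOn`, `IsLocalSliceTangentAt`, `HasNoLocalKillingFieldNear`, `AreDetectorsAt`, `SettlesWith`;
* (companion module `…Sig.lean`) §1 the six stub statements `Sig.stub_*` (the registered stubs of the
  skeleton are `theorem stub_X : Sig.stub_X`).

Everything is a definition over EXISTING declarations (`StationaryAFBlackHole`, `AdaptedChart`,
`StationaryFinalStateDecomposition`, `IsKillingModeStable`, `linearizedRicci`, `lieDerivBilin`,
`chartGramMatrix`, `admissibleVacuumData`, `InitialDataSet.IsSmoothDataFamily`, `VacuumCauchyDevelopment`,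
`Summit.FinalStateConjecture.HasCompleteNullInfinity/exteriorOf`); nothing restates a route item (the crux's
hypothesis `KerrOrBomb` and the glue consuming it stay in the skeleton). This module deliberately does NOT
import the route file `Theses.ZeroEnergyKerrOrBomb` (closing modules must stay importable by it).
-/

-- every `Summit.FinalStateConjecture.FinalStateConjecture.…` name repeats the summit = sub-problem segment (D-0017 layout)
set_option linter.dupNamespace false
set_option maxSynthPendingDepth 3

noncomputable section

open scoped Manifold ContDiff Topology BigOperators
open Set Filter Bundle MeasureTheory Literature.Geometry.Lorentzian

namespace Summit.FinalStateConjecture.FinalStateConjecture.Theorems.SymplecticDualOfTheBomb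

-- STABLE shared vocabulary (`SummitProperty`, `summit_iff`, `InTelescope`, `IsKerrExterior`,
-- `ChartIsAsymptoticallyCartesian`) = the landed Defs module of the sibling line (p85447)
open Summit.FinalStateConjecture.FinalStateConjecture.Theorems.OneLockedExplosion


/-! ## §0 Vocabulary (definitions over the tree; nothing is asserted here) -/

/-- The instance hypothesis `Kerr.Facts` of the Kerr–Schild prelude holds (three tree theorems). [folklore] -/
theorem kerrFacts : Kerr.Facts :=
  ⟨Kerr.isConnected_region_holds, Kerr.contMDiff_bilin_holds, Kerr.contMDiff_timeVector_holds⟩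

/-- **Killing-mode stability** of `□_g` — the tree's `StationaryAFBlackHole.IsKillingModeStable`
(verbatim the mode-stability hypothesis h6 of `KerrOrBomb`, `isKillingModeStable_iff` is `Iff.rfl`),
under the tree's Levi-Civita connection `PseudoRiemannianMetric.hasLeviCivita` (reshape r1: replaces
the planner's local restatement with a `∀ [HasLeviCivita]` binder). [cite: ShlapentokhRothman2015ModeStability, Def. 1.1 and §1.3] -/
def ModeStable (𝓑 : StationaryAFBlackHole.{0}) : Prop :=
  haveI : 𝓑.metric.HasLeviCivita := 𝓑.metric.toPseudoRiemannianMetric.hasLeviCivita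
  𝓑.IsKillingModeStable

/-- **`T`-equivariant, horizon-regular Kerr identification of a charted hole** (reshape r1; the
conclusion of R = `stub_kerrIsometryRigidity` and the per-hole hypothesis of F = `stub_chartTransfer`):
sub-extremal parameters `(M, a)`, a time-scale `c > 0`, an inner radius `r₋ < r₀ < r₊` and a map
`Θ : E4 → E4` (junk off `Kerr.region a r₀`) which on the horizon-penetrating Kerr–Schild region
`{r > r₀}` is smooth, injective, valued in the adapted chart domain `A.domain`, intertwines the
Kerr–Schild time translation with the chart's (`Θ (x + s e₀) = Θ x + (c s) e₀` — chart time IS the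
Killing parameter of `𝓑`, `AdaptedChart.mfderiv_toFun_basisVector`, and `T` is unnormalised, whence
`c`), is ISOMETRIC ON THE EXTERIOR `{r > r₊}` from the Kerr–Schild form `Kerr.bilin M a` to the chart
components `A.bilin = φ^* g_𝓑`, and is ANCHORED: the exterior goes exactly onto the chart preimage of
the d.o.c. (No isometry is asserted on the collar `{r₀ < r ≤ r₊}`: the interior of `𝓑` behind `𝓗⁺`
is not determined by its exterior — Ionescu–Klainerman's local non-Kerr stationary vacuum extensions,
barrier `IonescuKlainermanNonExtension` — only smoothness of `Θ` across `r = r₊`, which is what uniform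
`C³` control of the re-adapted late charts up to the horizon needs.) [cite: ChruscielCosta2008, Thm. 1.3] -/
def IsKerrCharted (𝓑 : StationaryAFBlackHole.{0}) (A : 𝓑.AdaptedChart) : Prop :=
  ∃ (M a c r₀ : ℝ) (Θ : E4 → E4), Kerr.IsSubextremal M a ∧ 0 < c ∧
    Kerr.rMinus M a < r₀ ∧ r₀ < Kerr.rPlus M a ∧
    ContDiffOn ℝ ∞ Θ (Kerr.region a r₀ : Set E4) ∧
    Set.InjOn Θ (Kerr.region a r₀ : Set E4) ∧
    Set.MapsTo Θ (Kerr.region a r₀ : Set E4) (A.domain : Set E4) ∧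
    (∀ x ∈ (Kerr.region a r₀ : Set E4), ∀ s : ℝ,
      Θ (x + s • E4.basisVector 0) = Θ x + (c * s) • E4.basisVector 0) ∧
    (∀ x ∈ (Kerr.exterior M a : Set E4), ∀ v w : E4,
      A.bilin (Θ x) (fderiv ℝ Θ x v) (fderiv ℝ Θ x w) = Kerr.bilin M a x v w) ∧
    Θ '' (Kerr.exterior M a : Set E4) = {u : E4 | ∃ h : u ∈ A.domain, A.toFun ⟨u, h⟩ ∈ 𝓑.doc}

/-- Fields of continuous bilinear forms on the tangent bundle of a stationary hole (metric
perturbations `h_{ab}`). [folklore] -/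
abbrev HoleBilinField (𝓑 : StationaryAFBlackHole.{0}) : Type :=
  Π p : 𝓑.carrier, TangentSpace (𝓡 4) p →L[ℝ] TangentSpace (𝓡 4) p →L[ℝ] ℝ

/-- **A growing GRAVITATIONAL Killing-mode pair `(h₁, h₂)` of rate `ν + iϖ` of the hole `𝓑`, read in
the adapted chart `A`** (the tensor twin of the route's scalar `IsKillingModePair`; card stub
"ProbeUniversality", triage r1-1 (b) / r1-3 cross-cutting note 1 with the regularity and outgoing
clauses spelled out): both fields symmetric; smooth on an open set containing `d.o.c. ∪ 𝓗⁺`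
(regular at the future horizon); solving linearised vacuum gravity `DRic_g(hᵢ) = 0` on the d.o.c.;
Killing eigen-equations `𝓛_T h₁ = ν h₁ − ϖ h₂`, `𝓛_T h₂ = ϖ h₁ + ν h₂` on the d.o.c.; OUTGOING in the
sense of the route (chart components bounded on the part of the d.o.c. in the chronological past of the
far slice region); and NOT pure gauge on the d.o.c. (no smooth `ξ₁, ξ₂` with `hᵢ = 𝓛_{ξᵢ} g` there). [cite: Wald1984GR, §7.5, (7.5.14)–(7.5.15)] -/
def IsGravitationalModePair (𝓑 : StationaryAFBlackHole.{0}) (A : 𝓑.AdaptedChart) (ν ϖ : ℝ)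
    (h₁ h₂ : HoleBilinField 𝓑) : Prop :=
  haveI : 𝓑.metric.HasLeviCivita := 𝓑.metric.hasLeviCivita
  (∀ p (v w : TangentSpace (𝓡 4) p), h₁ p v w = h₁ p w v ∧ h₂ p v w = h₂ p w v) ∧
  (∃ U : Set 𝓑.carrier, IsOpen U ∧ 𝓑.doc ∪ 𝓑.horizon ⊆ U ∧
    ContMDiffOn (𝓡 4) ((𝓡 4).prod 𝓘(ℝ, E4 →L[ℝ] E4 →L[ℝ] ℝ)) ∞
      (fun p ↦ TotalSpace.mk' (E4 →L[ℝ] E4 →L[ℝ] ℝ)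
        (E := fun p : 𝓑.carrier ↦ TangentSpace (𝓡 4) p →L[ℝ] TangentSpace (𝓡 4) p →L[ℝ] ℝ) p (h₁ p)) U ∧
    ContMDiffOn (𝓡 4) ((𝓡 4).prod 𝓘(ℝ, E4 →L[ℝ] E4 →L[ℝ] ℝ)) ∞
      (fun p ↦ TotalSpace.mk' (E4 →L[ℝ] E4 →L[ℝ] ℝ)
        (E := fun p : 𝓑.carrier ↦ TangentSpace (𝓡 4) p →L[ℝ] TangentSpace (𝓡 4) p →L[ℝ] ℝ) p (h₂ p)) U) ∧
  (∀ p ∈ 𝓑.doc, 𝓑.metric.toPseudoRiemannianMetric.linearizedRicci h₁ p = 0 ∧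
    𝓑.metric.toPseudoRiemannianMetric.linearizedRicci h₂ p = 0) ∧
  (∀ p ∈ 𝓑.doc,
    𝓑.metric.toPseudoRiemannianMetric.lieDerivBilin 𝓑.killing h₁ p = ν • h₁ p - ϖ • h₂ p ∧
      𝓑.metric.toPseudoRiemannianMetric.lieDerivBilin 𝓑.killing h₂ p = ϖ • h₁ p + ν • h₂ p) ∧
  (∃ C : ℝ, ∀ x : A.domain, A.toFun x ∈ 𝓑.doc ∩ 𝓑.metric.chronologicalPast 𝓑.timeOrientation
      (𝓑.embed '' 𝓑.e.far (𝓑.e.R + 1)) → ∀ v w : E4,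
    |pullbackBilin (I := 𝓡 4) (I' := 𝓘(ℝ, E4)) A.toFun h₁ x v w| ≤ C * ‖v‖ * ‖w‖ ∧
      |pullbackBilin (I := 𝓡 4) (I' := 𝓘(ℝ, E4)) A.toFun h₂ x v w| ≤ C * ‖v‖ * ‖w‖) ∧
  ¬ ∃ ξ₁ ξ₂ : (p : 𝓑.carrier) → TangentSpace (𝓡 4) p,
      ContMDiffOn (𝓡 4) ((𝓡 4).prod 𝓘(ℝ, E4)) ∞
        (fun p ↦ (TotalSpace.mk' E4 p (ξ₁ p) : TangentBundle (𝓡 4) 𝓑.carrier)) 𝓑.doc ∧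
      ContMDiffOn (𝓡 4) ((𝓡 4).prod 𝓘(ℝ, E4)) ∞
        (fun p ↦ (TotalSpace.mk' E4 p (ξ₂ p) : TangentBundle (𝓡 4) 𝓑.carrier)) 𝓑.doc ∧
      ∀ p ∈ 𝓑.doc, h₁ p = 𝓑.metric.toPseudoRiemannianMetric.lieDerivBilin ξ₁ 𝓑.metric.val p ∧
        h₂ p = 𝓑.metric.toPseudoRiemannianMetric.lieDerivBilin ξ₂ 𝓑.metric.val p

section Slice

variable {X : Type} [TopologicalSpace X] [ChartedSpace E3 X] [IsManifold (𝓡 3) ∞ X]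

/-- Fields of continuous bilinear forms on the slice (the type of `D.k`, of `δh`, `δk`, detectors). [folklore] -/
abbrev BilinField (X : Type) [TopologicalSpace X] [ChartedSpace E3 X] : Type :=
  Π x : X, TangentSpace (𝓡 3) x →L[ℝ] TangentSpace (𝓡 3) x →L[ℝ] ℝ

/-- The `h`-inner product `S_{ij} T^{ij} = tr (♯S ∘ ♯Tᵗ)` of two bilinear forms at `x` (the
polarisation of `PseudoRiemannianMetric.normSq`). [folklore] -/
def symInner (D : InitialDataSet (𝓡 3) X) (x : X)
    (S T : TangentSpace (𝓡 3) x →L[ℝ] TangentSpace (𝓡 3) x →L[ℝ] ℝ) : ℝ :=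
  LinearMap.trace ℝ (TangentSpace (𝓡 3) x)
    (((D.metric.sharp x).toLinearMap ∘ₗ S.toLinearMap₁₂) ∘ₗ
      ((D.metric.sharp x).toLinearMap ∘ₗ T.toLinearMap₁₂.flip))

/-- The `h`-trace `h^{ij} S_{ij}` of a bilinear form at `x`. [folklore] -/
def hTrace (D : InitialDataSet (𝓡 3) X) (x : X)
    (S : TangentSpace (𝓡 3) x →L[ℝ] TangentSpace (𝓡 3) x →L[ℝ] ℝ) : ℝ :=
  D.metric.trace x S.toLinearMap₁₂

/-- **The ADM symplectic density in the variables `(δh, δk)`.** With `π^{ij} = √h (k^{ij} − K h^{ij})`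
and two variations `(a₁, b₁) = (A, B)`, `(a₂, b₂) = (a, b)` of `(h, k)`, the antisymmetrised
`δ₁π^{ij} δ₂h_{ij} − δ₂π^{ij} δ₁h_{ij}` divided by `√h` is (the `tr(k a₁ a₂)` and `K⟨a₁, a₂⟩` terms being
symmetric) `⟨b₁,a₂⟩ − ⟨b₂,a₁⟩ − tr b₁ tr a₂ + tr b₂ tr a₁ − ½ tr a₁ ⟨k,a₂⟩ + ½ tr a₂ ⟨k,a₁⟩`
(ADM 1962; Moncrief 1975 §II; the overall sign / the tree's sign of `k` are immaterial below, where the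
density is only ever compared with `0`). [cite: Wald1984GR, Appendix E.2] -/
def omegaDensity (D : InitialDataSet (𝓡 3) X) (A B a b : BilinField X) (x : X) : ℝ :=
  symInner D x (B x) (a x) - symInner D x (b x) (A x)
    - hTrace D x (B x) * hTrace D x (a x) + hTrace D x (b x) * hTrace D x (A x)
    - hTrace D x (A x) * symInner D x (D.k x) (a x) / 2
    + hTrace D x (a x) * symInner D x (D.k x) (A x) / 2

/-- **The slice pairing `ω_{Σ₀}((A,B),(a,b))` read in the extended chart at `x₀`**: the integral of the
symplectic density against `√(det h_{ij}) dy` over the chart target (`chartGramMatrix`, `Volume.lean`).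
It is the invariant ADM pairing whenever `(a, b)` vanishes off a compact subset of the chart source —
the only way it is used below. [cite: Wald1984GR, Appendix E.2] -/
def chartPairing (D : InitialDataSet (𝓡 3) X) (x₀ : X) (A B a b : BilinField X) : ℝ :=
  ∫ y in (extChartAt (𝓡 3) x₀).target,
    omegaDensity D A B a b ((extChartAt (𝓡 3) x₀).symm y) *
      Real.sqrt (chartGramMatrix D.h x₀ y).det

/-- First-order tangent (metric part) at `c = 0` of a `k`-parameter family of data in the `j`-th
parameter direction: `∂/∂c_j h_c(x)|₀` (a derivative in the fibre, definitionally the model space). [folklore] -/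
def famTangentH {k : ℕ} (G : EuclideanSpace ℝ (Fin k) → InitialDataSet (𝓡 3) X) (j : Fin k) :
    BilinField X :=
  fun x ↦ deriv (fun s : ℝ ↦ (show E3 →L[ℝ] E3 →L[ℝ] ℝ from (G (EuclideanSpace.single j s)).h.inner x)) 0

/-- First-order tangent (`k` part): `∂/∂c_j k_c(x)|₀`. [folklore] -/
def famTangentK {k : ℕ} (G : EuclideanSpace ℝ (Fin k) → InitialDataSet (𝓡 3) X) (j : Fin k) :
    BilinField X :=
  fun x ↦ deriv (fun s : ℝ ↦ (show E3 →L[ℝ] E3 →L[ℝ] ℝ from (G (EuclideanSpace.single j s)).k x)) 0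

/-- The `k × k` pairing matrix of the tangents of a `k`-parameter family against `k` detectors
`(A l, B l)`, entry `(j, l) = ω((A l, B l), ∂_j G|₀)`. [folklore] -/
def pairingMatrix (D : InitialDataSet (𝓡 3) X) (x₀ : X) {k : ℕ} (A B : Fin k → BilinField X)
    (G : EuclideanSpace ℝ (Fin k) → InitialDataSet (𝓡 3) X) : Matrix (Fin k) (Fin k) ℝ :=
  Matrix.of fun j l ↦ chartPairing D x₀ (A l) (B l) (famTangentH G j) (famTangentK G j)

/-- The family `G` is a deformation of `D` supported in `K`: `G c = D` off `K` for every parameter. [folklore] -/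
def IsSupportedIn (D : InitialDataSet (𝓡 3) X) {k : ℕ}
    (G : EuclideanSpace ℝ (Fin k) → InitialDataSet (𝓡 3) X) (K : Set X) : Prop :=
  ∀ c x, x ∉ K → (G c).h.inner x = D.h.inner x ∧ (G c).k x = D.k x

/-- Smoothness of a bilinear-form field on a set (as a section of `Hom(TX, Hom(TX, ℝ))`, the spelling
of `InitialDataSet.contMDiff_k`). [folklore] -/
def SmoothBilinOn (A : BilinField X) (V : Set X) : Prop :=
  ContMDiffOn (𝓡 3) ((𝓡 3).prod 𝓘(ℝ, E3 →L[ℝ] E3 →L[ℝ] ℝ)) ∞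
    (fun x ↦ TotalSpace.mk' (E3 →L[ℝ] E3 →L[ℝ] ℝ)
      (E := fun x : X ↦ TangentSpace (𝓡 3) x →L[ℝ] TangentSpace (𝓡 3) x →L[ℝ] ℝ) x (A x)) V

variable [T2Space X] [SecondCountableTopology X] [ConnectedSpace X] {D : InitialDataSet (𝓡 3) X}

/-- **`(A, B)` is LOCALLY PURE GAUGE at `x₀`** (Moncrief's gauge directions `J∘DΦ*(N, Y)`, typed
convention-free): on some neighbourhood `V` of `x₀` it is the first variation at `s = 0` of the Cauchy
data `(ι_s^* g, K_{ν_s})` induced on a jointly smooth one-parameter deformation `ι_s` of the slice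
`ι_0 = ι` inside the vacuum development `𝒟`, `ν_s` the future unit normals (the infinitesimal
lapse–shift `(N, Y)` is the normal/tangential part of `∂_s ι_s|₀`; no condition off `V`). [cite: Wald1984GR, Appendix E.2] -/
def IsLocalSliceTangentAt (𝒟 : VacuumCauchyDevelopment D) (A B : BilinField X) (x₀ : X) : Prop :=
  haveI : 𝒟.metric.toPseudoRiemannianMetric.HasLeviCivita := 𝒟.metric.hasLeviCivita
  ∃ (V : Set X) (δ : ℝ), IsOpen V ∧ x₀ ∈ V ∧ 0 < δ ∧
    ∃ (ι : ℝ → X → 𝒟.carrier) (ν : (s : ℝ) → NormalField (𝓡 4) (ι s)),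
      ι 0 = 𝒟.embed ∧
      ContMDiffOn (𝓘(ℝ, ℝ).prod (𝓡 3)) (𝓡 4) ∞ (fun p : ℝ × X ↦ ι p.1 p.2) (Set.Ioo (-δ) δ ×ˢ V) ∧
      (∀ s ∈ Set.Ioo (-δ) δ, ∀ y ∈ V,
        (∀ v : TangentSpace (𝓡 3) y,
          𝒟.metric.val (ι s y) (ν s y) (mfderiv (𝓡 3) (𝓡 4) (ι s) y v) = 0) ∧
        𝒟.metric.val (ι s y) (ν s y) (ν s y) = -1 ∧
        𝒟.timeOrientation.IsFutureDirected (ν s y)) ∧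
      ∀ y ∈ V, ∀ v w : TangentSpace (𝓡 3) y,
        HasDerivAt (fun s : ℝ ↦ pullbackBilin (I := 𝓡 4) (I' := 𝓡 3) (ι s) 𝒟.metric.val y v w)
          (A y v w) 0 ∧
        HasDerivAt (fun s : ℝ ↦
          𝒟.metric.toPseudoRiemannianMetric.secondFundamentalForm (𝓡 3) (ι s) (ν s) y v w) (B y v w) 0

/-- **No Killing initial data near `x₀`** (KIDs = Killing fields of the development, Moncrief 1975):
on some neighbourhood `V` of `x₀`, every vector field which is smooth and Killing on an open set of
the development containing `ι(V)` vanishes on `ι(V)` (hence, its full 1-jet vanishing there, near it).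
The hypothesis under which compactly supported solutions of the constraints near `x₀` form a manifold
with tangent space the compactly supported linearised solutions (Corvino–Schoen, Chruściel–Delay). [cite: ONeill1983, Ch. 9, Def. 9.22 and Prop. 9.25] -/
def HasNoLocalKillingFieldNear (𝒟 : VacuumCauchyDevelopment D) (x₀ : X) : Prop :=
  haveI : 𝒟.metric.toPseudoRiemannianMetric.HasLeviCivita := 𝒟.metric.hasLeviCivita
  ∃ V : Set X, IsOpen V ∧ x₀ ∈ V ∧
    ∀ (W : Set 𝒟.carrier), IsOpen W → 𝒟.embed '' V ⊆ W →
      ∀ ξ : (p : 𝒟.carrier) → TangentSpace (𝓡 4) p,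
        ContMDiffOn (𝓡 4) ((𝓡 4).prod 𝓘(ℝ, E4)) ∞
          (fun p ↦ (TotalSpace.mk' E4 p (ξ p) : TangentBundle (𝓡 4) 𝒟.carrier)) W →
        (∀ p ∈ W, ∀ Y₀ Z₀ : TangentSpace (𝓡 4) p,
          𝒟.metric.val p (𝒟.metric.toPseudoRiemannianMetric.leviCivita ξ p Y₀) Z₀ +
            𝒟.metric.val p Y₀ (𝒟.metric.toPseudoRiemannianMetric.leviCivita ξ p Z₀) = 0) →
        ∀ x ∈ V, ξ (𝒟.embed x) = 0

/-- **Detectors at `x₀`**: `k` pairs `(Aⱼ, Bⱼ)` of bilinear-form fields on the slice such that `x₀` is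
free of local Killing initial data, every `Aⱼ, Bⱼ` is smooth on a neighbourhood of `x₀` (they may be
rough — e.g. conormal along a 2-surface — elsewhere), and NO non-trivial real combination of them is
locally pure gauge at `x₀`. [folklore] -/
def AreDetectorsAt (𝒟 : VacuumCauchyDevelopment D) (x₀ : X) {k : ℕ} (A B : Fin k → BilinField X) :
    Prop :=
  HasNoLocalKillingFieldNear 𝒟 x₀ ∧
  (∃ V : Set X, IsOpen V ∧ x₀ ∈ V ∧ ∀ j, SmoothBilinOn (A j) V ∧ SmoothBilinOn (B j) V) ∧
  ∀ a : Fin k → ℝ, a ≠ 0 →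
    ¬ IsLocalSliceTangentAt 𝒟 (fun x ↦ ∑ j, a j • A j x) (fun x ↦ ∑ j, a j • B j x) x₀

end Slice

/-- **"Every MGHD of `D` settles down to regular stationary vacuum holes with property `Q`"**: every
maximal vacuum Cauchy development has complete `𝓘⁺` (sojourn form) and a `C²` stationary final-state
decomposition `d` (`StationaryFinalStateDecomposition`, definition D3 of the route) of its
self-determined exterior `O = J⁺(ιX) ∩ I⁻(d.charted)` with EXHAUSTIVE charts, whose adapted hole
charts cross the future event horizons (collar) and are asymptotically Cartesian immersions with
spacelike leaves reaching `i⁰` (`ChartIsAsymptoticallyCartesian`, reshape r1), and whose holes are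
REGULAR (`InTelescope`, `KerrOrBomb`'s telescope) and satisfy `Q`. MGHD existence is NOT included (it is
the shared obligation `MGHDExists`). [cite: DafermosLuk2017, §1.2.1] -/
def SettlesWith (Q : StationaryAFBlackHole.{0} → Prop) (X : Type) [TopologicalSpace X]
    [ChartedSpace E3 X] [IsManifold (𝓡 3) ∞ X] [T2Space X] [SecondCountableTopology X]
    [ConnectedSpace X] (D : InitialDataSet (𝓡 3) X) : Prop :=
  ∀ 𝒟 : VacuumCauchyDevelopment D, 𝒟.IsMaximal →
    Summit.FinalStateConjecture.HasCompleteNullInfinity 𝒟.toCauchyDevelopment ∧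
      ∃ (O : Set 𝒟.carrier) (d : StationaryFinalStateDecomposition 𝒟.toSpacetime O 2),
        O = Summit.FinalStateConjecture.exteriorOf 𝒟.toCauchyDevelopment d.charted ∧
          d.HasExhaustiveCharts ∧
            ∀ i, (d.hole i).horizon ⊆ Set.range (d.adapted i).toFun ∧
              ChartIsAsymptoticallyCartesian (d.adapted i) ∧
                InTelescope (d.hole i) ∧ Q (d.hole i)

/-- Read-back of `SettlesWith` (definitional): complete `𝓘⁺` and an exhaustive regular `C²` stationary
decomposition with property `Q`, for every MGHD. Registration device of this Defs module (as
`OneLockedExplosion.summit_iff` / `settlesTo_iff`). [folklore] -/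
theorem settlesWith_iff : ∀ (Q : StationaryAFBlackHole.{0} → Prop) (X : Type) [TopologicalSpace X] [ChartedSpace E3 X] [IsManifold (𝓡 3) ∞ X] [T2Space X] [SecondCountableTopology X] [ConnectedSpace X] (D : InitialDataSet (𝓡 3) X), SettlesWith Q X D ↔ ∀ 𝒟 : VacuumCauchyDevelopment D, 𝒟.IsMaximal → Summit.FinalStateConjecture.HasCompleteNullInfinity 𝒟.toCauchyDevelopment ∧ ∃ (O : Set 𝒟.carrier) (d : StationaryFinalStateDecomposition 𝒟.toSpacetime O 2), O = Summit.FinalStateConjecture.exteriorOf 𝒟.toCauchyDevelopment d.charted ∧ d.HasExhaustiveCharts ∧ ∀ i, (d.hole i).horizon ⊆ Set.range (d.adapted i).toFun ∧ ChartIsAsymptoticallyCartesian (d.adapted i) ∧ InTelescope (d.hole i) ∧ Q (d.hole i) :=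
  fun _ _ _ _ _ _ _ _ _ ↦ Iff.rfl

end Summit.FinalStateConjecture.FinalStateConjecture.Theorems.SymplecticDualOfTheBomb

end
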